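import Summits.CriticalPhenomena.PercolationContinuityZ3.Theorems.PercNearOneGluingNoHeavyLowerTailMajorityGluingQCert
import HarnessLib

/-!
# Data of the `(7,5)` certificate with constant `59/50`: squares, part 1 (lane prim-rate, constants-miner 1, gen 35; CANDIDATES §GEN-35)

Support file for the closed crux `NoHeavyLowerTail` (stmt-CriticalPhenomena-4575), majority-gluing line.  The degree-2 certificate census/g35/jobs/j276953/CERT5_7_5_c59over50.json (mine-1 gen 35, kit j276953: cert5.py — cutting planes on the moment side over ALL hub-rooted van den Berg–Kahn rows and the 2×2 squares of variables/cylinders, case family `A` = «`E_x = μ(x attached, ≥ 5 cut)`», exact INTEGER multipliers (956 linear entries in 128 groups, 494 row instances, 17 squares), re-verified in the Lean semantics by census/g35/cert/gen5.py: `S ≥ 0` on all 8 385 pairs; variables `x_K`, `K < 128` = cut patterns of seven relays, `x_128 = δ`).  Data only.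
-/

namespace Summit.CriticalPhenomena.PercolationContinuityZ3.Theorems

namespace HubOnly
namespace QCert

/-- Squares of the `(7,5)` `59/50` certificate, part 1. -/
def sevenFive59Sqs1 : List (List SqE) := [
  [⟨7, 20, 102115961431, 340282366920938463463374607431768211456, 256208696187542534502208810869036417024⟩,
   ⟨7, 20, 106162423028, 340282366920938463463374607431768211456, 225968759283435698393647200247658577920⟩,
   ⟨9, 46, 17968310054, 340282366920938463463374607431768211456, 255211775190703847597530955573826158592⟩,
   ⟨9, 46, 24952520693, 340282366920938463463374607431768211456, 180775007426748558714917760198126862336⟩,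
   ⟨9, 46, 31907745419, 340282366920938463463374607431768211456, 212676479325586539664609129644855132160⟩,
   ⟨9, 46, 9905382109, 340282366920938463463374607431768211456, 170805797458361689668139207246024278016⟩,
   ⟨8, 23, 482927479507, 340282366920938463463374607431768211456, 170141183460469231740910675752738881536⟩,
   ⟨8, 23, 246397225491, 340282366920938463463374607431768211456, 170141183500083312988819472512656080896⟩,
   ⟨9, 26, 487816524318, 340282366920938463463374607431768211456, 170143779608898499145501568964048715776⟩,
   ⟨3, 8, 628762217125, 340282366920938463463374607431768211456, 255211775250124969483229208768984121344⟩,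
   ⟨3, 8, 372188835979, 340282366920938463463374607431768211456, 170805797458361689677398608079898017792⟩,
   ⟨3, 8, 644091423126, 340282366920938463463374607431768211456, 180775007468838520050620689544697085952⟩,
   ⟨3, 8, 433080208504, 340282366920938463463374607431768211456, 180775007426748558724717592987285061632⟩,
   ⟨3, 8, 617780853447, 340282366920938463463374607431768211456, 212676479375104141236024340640820101120⟩,
   ⟨3, 8, 586182185300, 340282366920938463463374607431768211456, 170805797498130513430182048577158643712⟩,
   ⟨3, 8, 441761836535, 340282366920938463463374607431768211456, 255211775190703847611366013629108322304⟩,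
   ⟨3, 8, 30622365589, 340282366920938463463374607431768211456, 212679724511123123931876961205060894720⟩]]

end QCert
end HubOnly

end Summit.CriticalPhenomena.PercolationContinuityZ3.Theorems
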